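import Summits.Ventures.PercRepro.SixFourResidueSize
import Summits.Ventures.PercRepro.SixFourPLPlanes
import Summits.Ventures.PercRepro.SixFourPLCovPairs3

/-!
# PercRepro — C-025 at `(6,4)`: Lemma X̄₂ (E21-1 (b)), part A — the three shapes of a set counted by `X₂` (p2, gen 8)

For a normalisation `D` of a plane-line set and a set `Z ⊆ G` of rank `≤ 2` whose complement lies in a plane `P′`
with a rank-`3` trace (`exists_plane_superset3`), `plane_trichotomy` gives three shapes:
* `P′ = P₀`: `L ⊆ Z ⊆ ℓ ∩ G`, so `Z ∈ {L, L ∪ (ℓ ∩ ρ)}` (`shape_P₀`);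
* `P′ = Π_y`: `ρ ∖ λ_y ⊆ Z ⊆ cl(ρ ∖ λ_y) ∩ ρ`, a line trace `μ ∩ ρ` with `|μ ∩ ρ| ≤ |ρ ∖ λ_y| + 1`, so `Z` is one of two
  sets and a line with `p − s_y` or `p − s_y + 1` points exists (`shape_Pi`);
* `P′ ∩ G = {x} ∪ λ` (`λ` a non-class line trace): `(ρ ∖ λ) ∪ (L ∖ {x}) ⊆ Z` is collinear, so `ρ ∖ λ ⊆ ℓ ∩ ρ` — the
  meeting case with `|λ| = p − 1` — and `Z ∈ {ℓ′ ∖ {x}, ℓ′}` (`shape_third`).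
-/

namespace PercRepro.SixFour

open Finset ThmH

variable {α : Type*} [DecidableEq α] {M : Matroid α} [M.Finite] {G : Finset α}

namespace PLData

variable {D : PLData M G}

/-- A set of rank `≤ 2` containing `≥ 2` points of `L` lies in `ℓ`. -/
theorem subset_ellF_of_two_mem_L (hs : Simple M) (hG : G ⊆ gr M) {Z : Finset α} (hZG : Z ⊆ G)
    (hZ2 : M.eRk (Z : Set α) ≤ 2) {u v : α} (hu : u ∈ D.L) (hv : v ∈ D.L) (huv : u ≠ v) (huZ : u ∈ Z)
    (hvZ : v ∈ Z) : Z ⊆ D.ellF := by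
  have hZg : Z ⊆ gr M := hZG.trans hG
  have e1 := closure_pair_eq_of_eRk_le_two hs hZg hZ2 huZ hvZ huv
  have e2 := closure_pair_eq_of_eRk_le_two hs (D.L_subset.trans hG) D.rank_rest hu hv huv
  intro z hz
  unfold ellF
  rw [mem_clF, ← e2, e1]
  exact M.subset_closure _ (by rw [← coe_gr]; exact_mod_cast hZg) (Finset.mem_coe.2 hz)

/-- **Shape `P₀`**: if `G ∖ Z ⊆ P₀` and `r(Z) ≤ 2`, then `Z = L` or `Z = L ∪ (ℓ ∩ ρ)`. -/
theorem shape_P₀ (hs : Simple M) (hG : G ⊆ gr M) (h3 : 3 ≤ D.L.card) {Z : Finset α} (hZG : Z ⊆ G)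
    (hZ2 : M.eRk (Z : Set α) ≤ 2) (hc : G \ Z ⊆ D.P₀) : Z = D.L ∨ Z = D.L ∪ (D.ellF ∩ D.ρ) := by
  have h2 : 2 ≤ D.L.card := by omega
  have hLZ : D.L ⊆ Z := by
    intro x hx
    by_contra hxZ
    have : x ∈ G \ Z := Finset.mem_sdiff.2 ⟨D.L_subset hx, hxZ⟩
    exact (Finset.mem_sdiff.1 hx).2 (hc this)
  obtain ⟨u, hu, v, hv, huv⟩ := Finset.one_lt_card.1 (by omega : 1 < D.L.card)
  have hZℓ : Z ⊆ D.ellF := subset_ellF_of_two_mem_L hs hG hZG hZ2 hu hv huv (hLZ hu) (hLZ hv)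
  have hZsub : Z ⊆ D.L ∪ (D.ellF ∩ D.ρ) := by
    intro z hz
    have := Finset.mem_inter.2 ⟨hZℓ hz, hZG hz⟩
    rw [ellF_inter_G_eq hs hG h2] at this
    exact this
  by_cases hz : (D.ellF ∩ D.ρ) ⊆ Z
  · right
    exact Finset.Subset.antisymm hZsub (Finset.union_subset hLZ hz)
  · left
    refine Finset.Subset.antisymm ?_ hLZ
    intro z hz'
    rcases Finset.mem_union.1 (hZsub hz') with h | h
    · exact h
    · -- `ℓ ∩ ρ` has at most one point; it is in `Z`, contradiction with `hz`
      exfalso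
      apply hz
      intro w hw
      have hcard := D.card_ellF_inter_le_one hs hG h2
      have hsub : D.ellF ∩ D.ρ ⊆ D.ellF ∩ D.P₀ :=
        Finset.inter_subset_inter (Finset.Subset.refl _) Finset.inter_subset_left
      have h1 : (D.ellF ∩ D.ρ).card ≤ 1 := (Finset.card_le_card hsub).trans hcard
      have : w = z := by
        by_contra hne
        have := Finset.one_lt_card.2 ⟨w, hw, z, h, hne⟩
        omega
      rw [this]
      exact hz'

/-- **Shape `Π_y`**: if `G ∖ Z ⊆ Π_y` (`y ∈ ρ ∖ ℓ`) and `r(Z) ≤ 2`, then `ρ ∖ λ_y ⊆ Z ⊆ μ ∩ ρ` with `μ = cl(ρ ∖ λ_y)` a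
line of `M`, `|μ ∩ ρ| ≤ |ρ ∖ λ_y| + 1`, and `Z = ρ ∖ λ_y` or `Z = μ ∩ ρ`. -/
theorem shape_Pi (hs : Simple M) (hG : G ⊆ gr M) (h2 : 2 ≤ D.L.card) {y : α} (hy : y ∈ D.ρ \ D.ellF)
    (hcap : (D.lam y).card + 3 ≤ D.ρ.card) {Z : Finset α} (hZG : Z ⊆ G) (hZ2 : M.eRk (Z : Set α) ≤ 2)
    (hc : G \ Z ⊆ D.Pi y) :
    clF M (D.ρ \ D.lam y) ∈ lines M ∧ D.ρ \ D.lam y ⊆ clF M (D.ρ \ D.lam y) ∩ D.ρ ∧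
      (clF M (D.ρ \ D.lam y) ∩ D.ρ).card ≤ (D.ρ \ D.lam y).card + 1 ∧
      (Z = D.ρ \ D.lam y ∨ Z = clF M (D.ρ \ D.lam y) ∩ D.ρ) := by
  rw [Finset.mem_sdiff] at hy
  set C := D.ρ \ D.lam y with hCdef
  have hCρ : C ⊆ D.ρ := Finset.sdiff_subset
  have hCg : C ⊆ gr M := hCρ.trans (D.ρ_subset.trans hG)
  -- `C ⊆ Z`
  have hCZ : C ⊆ Z := by
    intro w hw
    by_contra hwZ
    have hwG : w ∈ G \ Z := Finset.mem_sdiff.2 ⟨D.ρ_subset (Finset.mem_sdiff.1 hw).1, hwZ⟩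
    have hwPi := hc hwG
    exact (Finset.mem_sdiff.1 hw).2 (Finset.mem_inter.2 ⟨hwPi, (Finset.mem_sdiff.1 hw).1⟩)
  -- `|C| ≥ 3`, so `C` has rank `2` (as a subset of `Z`)
  have hCcard : 3 ≤ C.card := by
    have hsum : C.card + (D.lam y).card = D.ρ.card := by
      rw [hCdef]
      have := Finset.card_sdiff_add_card_inter D.ρ (D.lam y)
      have hli : D.ρ ∩ D.lam y = D.lam y := Finset.inter_eq_right.2 (Finset.inter_subset_right : D.lam y ⊆ D.ρ)
      rw [hli] at this
      exact this
    omega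
  have hCr : M.eRk (C : Set α) = 2 :=
    le_antisymm ((M.eRk_mono (Finset.coe_subset.2 hCZ)).trans hZ2) (two_le_eRk_of_two_le_card hs hCg (Finset.Subset.refl _) (by omega))
  obtain ⟨hμ, hCμ⟩ := clF_mem_lines hCg hCr
  have hbound : (clF M C ∩ D.ρ).card ≤ C.card + 1 := by
    have hsub : clF M C ∩ D.ρ ⊆ C ∪ (clF M C ∩ D.lam y) := by
      intro w hw
      rw [Finset.mem_inter] at hw
      rw [Finset.mem_union, Finset.mem_inter]
      by_cases hwl : w ∈ D.lam y
      · exact Or.inr ⟨hw.1, hwl⟩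
      · exact Or.inl (Finset.mem_sdiff.2 ⟨hw.2, hwl⟩)
    have hone : (clF M C ∩ D.lam y).card ≤ 1 := by
      rw [Finset.card_le_one]
      intro u hu v hv
      by_contra huv
      rw [Finset.mem_inter] at hu hv
      -- `μ` would contain two points of the class `λ_y` (rank `≤ 2`), hence `λ_y ⊆ μ`, and then `C ⊆ λ_y`... contradiction
      -- simpler: `u, v ∈ λ_y` span the class line; `μ = cl{u, v}`; then `C ⊆ μ ∩ ρ ⊆ Π_y ∩ ρ = λ_y`, but `C ∩ λ_y = ∅`
      have hlam2 := eRk_lam_le_two hs hG h2 (D.ρ_subset hy.1) hy.2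
      have hlamg : D.lam y ⊆ gr M := Finset.inter_subset_right.trans (D.ρ_subset.trans hG)
      have e1 := closure_pair_eq_of_eRk_le_two hs hlamg hlam2 hu.2 hv.2 huv
      have hμr : M.eRk ((clF M C : Finset α) : Set α) = 2 := (mem_lines.1 hμ).2.2
      have hμg : clF M C ⊆ gr M := (mem_lines.1 hμ).1
      have e2 := closure_pair_eq_of_eRk_le_two hs hμg hμr.le hu.1 hv.1 huv
      -- `C ⊆ μ = cl(μ) = cl{u,v} = cl(λ_y) ⊆ Π_y`
      obtain ⟨w, hw⟩ := Finset.card_pos.1 (by omega : 0 < C.card)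
      have hwμ : w ∈ clF M C := hCμ hw
      have hwPi : w ∈ D.Pi y := by
        have h1 : (clF M C : Set α) = M.closure (D.lam y : Set α) := by
          calc (clF M C : Set α) = M.closure (C : Set α) := coe_clF M C
            _ = M.closure ((clF M C : Finset α) : Set α) := by rw [coe_clF, M.closure_closure]
            _ = M.closure (({u, v} : Finset α) : Set α) := e2.symm
            _ = M.closure (D.lam y : Set α) := e1
        have h2' : M.closure (D.lam y : Set α) ⊆ (D.Pi y : Set α) := by
          calc M.closure (D.lam y : Set α) ⊆ M.closure (D.Pi y : Set α) :=
                M.closure_subset_closure (Finset.coe_subset.2 Finset.inter_subset_left)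
            _ = (D.Pi y : Set α) := (mem_planes.1 (Pi_mem_planes hs hG h2 (D.ρ_subset hy.1) hy.2).1).2.1.closure
        exact Finset.mem_coe.1 (h2' (h1 ▸ Finset.mem_coe.2 hwμ))
      exact (Finset.mem_sdiff.1 hw).2 (Finset.mem_inter.2 ⟨hwPi, (Finset.mem_sdiff.1 hw).1⟩)
    calc (clF M C ∩ D.ρ).card ≤ (C ∪ (clF M C ∩ D.lam y)).card := Finset.card_le_card hsub
      _ ≤ C.card + (clF M C ∩ D.lam y).card := Finset.card_union_le _ _
      _ ≤ C.card + 1 := by omega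
  refine ⟨hμ, Finset.subset_inter hCμ hCρ, hbound, ?_⟩
  -- `Z ⊆ μ ∩ ρ`: `Z ⊆ cl(C) = μ` (rank `2`, `C ⊆ Z`) and `Z ⊆ ρ` (`Z ∩ L = ∅` as `μ ⊆ P₀`)
  have hZμ : Z ⊆ clF M C := by
    intro z hz
    rw [mem_clF]
    obtain ⟨u, hu, v, hv, huv⟩ := Finset.one_lt_card.1 (by omega : 1 < C.card)
    have e1 := closure_pair_eq_of_eRk_le_two hs (hZG.trans hG) hZ2 (hCZ hu) (hCZ hv) huv
    have e2 := closure_pair_eq_of_eRk_le_two hs hCg hCr.le hu hv huv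
    rw [← e2, e1]
    exact M.subset_closure _ (by rw [← coe_gr]; exact_mod_cast hZG.trans hG) (Finset.mem_coe.2 hz)
  have hZρ : Z ⊆ D.ρ := by
    intro z hz
    have hzμ := hZμ hz
    have hμP : clF M C ⊆ D.P₀ := by
      intro w hw
      rw [mem_clF] at hw
      have : M.closure (C : Set α) ⊆ (D.P₀ : Set α) := by
        calc M.closure (C : Set α) ⊆ M.closure (D.P₀ : Set α) :=
              M.closure_subset_closure (Finset.coe_subset.2 (hCρ.trans Finset.inter_subset_left))
          _ = (D.P₀ : Set α) := (mem_planes.1 D.plane).2.1.closure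
      exact Finset.mem_coe.1 (this hw)
    exact Finset.mem_inter.2 ⟨hμP hzμ, hZG hz⟩
  have hZsub : Z ⊆ clF M C ∩ D.ρ := Finset.subset_inter hZμ hZρ
  by_cases heq : Z = C
  · exact Or.inl heq
  · right
    -- `C ⊊ Z ⊆ μ ∩ ρ` with `|μ ∩ ρ| ≤ |C| + 1` forces `Z = μ ∩ ρ`
    have hlt : C.card < Z.card := Finset.card_lt_card (Finset.ssubset_iff_subset_ne.2 ⟨hCZ, fun h => heq h.symm⟩)
    have hle := Finset.card_le_card hZsub
    exact Finset.eq_of_subset_of_card_le hZsub (by omega)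

end PLData

end PercRepro.SixFour
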